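import Literature.NumberTheory.Automorphic.UnitaryGroupArithmeticLevels
import Literature.NumberTheory.Automorphic.UnitaryGroupFormTransport
import HarnessLib

/-!
# Transport of finite-adelic unitary groups and arithmetic levels along a rational similitude

For a quadratic extension `E/F` of number fields with involution `c` and two matrices `J, J' ∈ M_N(E)` related by a
RATIONAL SIMILITUDE `ᵗ(cB) · (a • J) · B = J'` (`B ∈ GL_N(E)`, `a ∈ Eˣ`; e.g. two hermitian forms with the same signatures
in odd rank, Landherr's theorem `hermitianMatrices_similar_of_posIndex_eq`), conjugation by the diagonal image `B_f` of `B`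
in `GL_N(𝔸_E^∞)` identifies the finite-adelic unitary groups and transports arithmetic levels WITHOUT denominators:

* `unitaryGroupOfForm_smul_of_isUnit` — `U(σ, a • H) = U(σ, H)` for a unit scalar (any commutative ring);
  `formCongr_map` — `f(ᵗ(σT) H T) = ᵗ(τ f(T)) f(H) f(T)` for `f ∘ σ = τ ∘ f`;
* `UnitaryGroup.finAdelic_smul`, `UnitaryGroup.rational_smul` — the scalar is invisible to `U(J)(𝔸_{F,f})`, `U(J)(F)`;
* **`UnitaryGroup.finAdelicCongr B ha h : U(J')(𝔸_{F,f}) ≃ₜ* U(J)(𝔸_{F,f})`**, `g ↦ B_f g B_f⁻¹` (topological groups), and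
  `conj_mem_rational_iff` — `γ ∈ U(J')(F) ↔ B γ B⁻¹ ∈ U(J)(F)`;
* **`UnitaryGroup.arithmeticLevel_transport`** — for `K ≤ U(J)(𝔸_{F,f})` and `K' := (finAdelicCongr)⁻¹(K) ≤ U(J')(𝔸_{F,f})`:
  `Γ(K') = B⁻¹ Γ(K) B`, i.e. `γ ∈ Γ(K') ↔ B γ B⁻¹ ∈ Γ(K)` (`mem_arithmeticLevel_transport_iff`); `K'` is compact / open when `K`
  is (`isCompact_comap_finAdelicCongr`, `isOpen_comap_finAdelicCongr`).

So the arithmetic quotients attached to `J` and `J'` range over the same commensurability data: every arithmetic level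
`Γ(K)` of `U(J)` is `GL_N(E)`-conjugate to an arithmetic level of `U(J')` cut out by a compact open subgroup.  All
statements are proved; nothing is cited as a record.  Reference for the objects: Platonov–Rapinchuk 1994, §2.3 (equivalent
forms have conjugate unitary groups) and §4.1 (arithmetic subgroups `G_F ∩ K` are stable under `G(F)`-conjugation up to
commensurability; here exactly, because the level is transported adelically).

Provenance: cell pub-hodgecm2 (COR-CM), seat b06 gen 22 — the adelic half of «one tower per field» (junction-B01 ideation
memo IDEA-1g, route L1g-A, row `TowerDominance`): any two hermitian 3-spaces of PerL's signature give conjugate towers of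
compact ball quotients.
-/

noncomputable section

open NumberField IsDedekindDomain
open scoped Matrix MatrixGroups

namespace Literature.NumberTheory.Automorphic

/-! ## 0. Two generic identities for `unitaryGroupOfForm` -/

section Generic

variable {R : Type*} [CommRing R] {n : Type*} [Fintype n] [DecidableEq n] (σ : R →+* R)

/-- **Rescaling by a unit does not change the unitary group**: `U(σ, a • H) = U(σ, H)` (the unitary group of a form
depends only on its similarity class). [cite: PlatonovRapinchuk1994, §2.3] -/
theorem unitaryGroupOfForm_smul_of_isUnit {a : R} (ha : IsUnit a) (H : Matrix n n R) :
    unitaryGroupOfForm σ (a • H) = unitaryGroupOfForm σ H := by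
  ext g
  rw [mem_unitaryGroupOfForm_iff, mem_unitaryGroupOfForm_iff, Matrix.mul_smul, Matrix.smul_mul]
  exact ha.smul_left_cancel

/-- **Change of basis commutes with change of rings**: for `f : R →+* S` with `f ∘ σ = τ ∘ f`,
`f(ᵗ(σT) · H · T) = ᵗ(τ f(T)) · f(H) · f(T)` (change of basis of a sesquilinear form is compatible with extension
of scalars, e.g. `E → E_w`, `E → 𝔸_E`). [cite: PlatonovRapinchuk1994, §2.3] -/
theorem formCongr_map {S : Type*} [CommRing S] {τ : S →+* S} (f : R →+* S) (hf : ∀ x, f (σ x) = τ (f x))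
    (T : GL n R) (H : Matrix n n R) :
    (formCongr σ T H).map f = formCongr τ (Matrix.GeneralLinearGroup.map f T) (H.map f) := by
  have hT : ((Matrix.GeneralLinearGroup.map f T : GL n S) : Matrix n n S) = (T : Matrix n n R).map f := rfl
  have hcomp : (f ∘ σ : R → S) = (τ ∘ f : R → S) := funext hf
  simp only [formCongr, Matrix.map_mul, Matrix.transpose_map, Matrix.map_map, hT, hcomp]

end Generic

namespace UnitaryGroup

variable (F E : Type) [Field F] [NumberField F] [Field E] [NumberField E] [Algebra F E]
variable (c : E ≃ₐ[F] E) (N : ℕ)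

/-! ## 1. The diagonal `GL_N(E) → GL_N(𝔸_E^∞)` and the scalar -/

/-- The diagonal embedding `GL_N(E) →* GL_N(𝔸_E^∞)` (`GL_N` of `E → 𝔸_E^∞`); on `U(J)(F)` it is `rationalToFinAdelic`
(`coe_rationalToFinAdelic`). [cite: PlatonovRapinchuk1994, §5.1] -/
abbrev toFinAdeleGL : GL (Fin N) E →* GL (Fin N) (FiniteAdeleRing (𝓞 E) E) :=
  Matrix.GeneralLinearGroup.map (algebraMap E (FiniteAdeleRing (𝓞 E) E))

omit [NumberField F] in
/-- `(a • J)_{𝔸_f} = a_{𝔸_f} • J_{𝔸_f}` (the form read over the finite adeles). [cite: PlatonovRapinchuk1994, §5.1] -/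
theorem finiteAdelicForm_smul (a : E) (J : Matrix (Fin N) (Fin N) E) :
    finiteAdelicForm E N (a • J) = algebraMap E (FiniteAdeleRing (𝓞 E) E) a • finiteAdelicForm E N J := by
  ext i j
  simp [finiteAdelicForm, Matrix.map_apply, Matrix.smul_apply, map_mul, smul_eq_mul]

omit [NumberField F] in
/-- `(ᵗ(cB) · J · B)_{𝔸_f} = ᵗ((c ⊗ 1) B_f) · J_{𝔸_f} · B_f` (change of basis read over the finite adeles).
[cite: PlatonovRapinchuk1994, §5.1] -/
theorem finiteAdelicForm_formCongr (B : GL (Fin N) E) (J : Matrix (Fin N) (Fin N) E) :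
    finiteAdelicForm E N (formCongr (c : E →+* E) B J) =
      formCongr (conjFiniteAdele F E c) (toFinAdeleGL E N B) (finiteAdelicForm E N J) :=
  formCongr_map (c : E →+* E) (algebraMap E _) (algebraMap_galConj_finiteAdele F E c) B J

omit [NumberField F] in
/-- **`U(a • J)(𝔸_{F,f}) = U(J)(𝔸_{F,f})`** for `a ≠ 0`. [cite: PlatonovRapinchuk1994, §2.3] -/
theorem finAdelic_smul {a : E} (ha : a ≠ 0) (J : Matrix (Fin N) (Fin N) E) :
    finAdelic F E c N (a • J) = finAdelic F E c N J := by
  change unitaryGroupOfForm _ (finiteAdelicForm E N (a • J)) = unitaryGroupOfForm _ (finiteAdelicForm E N J)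
  rw [finiteAdelicForm_smul]
  exact unitaryGroupOfForm_smul_of_isUnit _ ((IsUnit.mk0 a ha).map _) _

omit [NumberField F] [NumberField E] in
/-- **`U(a • J)(F) = U(J)(F)`** for `a ≠ 0`. [cite: PlatonovRapinchuk1994, §2.3] -/
theorem rational_smul {a : E} (ha : a ≠ 0) (J : Matrix (Fin N) (Fin N) E) :
    rational F E c N (a • J) = rational F E c N J :=
  unitaryGroupOfForm_smul_of_isUnit _ (IsUnit.mk0 a ha) _

/-! ## 2. Conjugation by a rational similitude -/

variable {N}
variable (B : GL (Fin N) E)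

omit [NumberField F] in
/-- **Finite-adelic membership transport**: for `ᵗ(cB) · (a • J) · B = J'`,
`g ∈ U(J')(𝔸_{F,f}) ↔ B_f g B_f⁻¹ ∈ U(J)(𝔸_{F,f})`. [cite: PlatonovRapinchuk1994, §2.3] -/
theorem conj_mem_finAdelic_iff {a : E} (ha : a ≠ 0) {J J' : Matrix (Fin N) (Fin N) E}
    (h : formCongr (c : E →+* E) B (a • J) = J') (g : GL (Fin N) (FiniteAdeleRing (𝓞 E) E)) :
    g ∈ finAdelic F E c N J' ↔ toFinAdeleGL E N B * g * (toFinAdeleGL E N B)⁻¹ ∈ finAdelic F E c N J := by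
  rw [← finAdelic_smul F E c N ha J]
  change _ ↔ _ ∈ unitaryGroupOfForm _ (finiteAdelicForm E N (a • J))
  rw [conj_mem_unitaryGroupOfForm_iff, ← finiteAdelicForm_formCongr, h]
  rfl

omit [NumberField F] [NumberField E] in
/-- **Rational membership transport**: `γ ∈ U(J')(F) ↔ B γ B⁻¹ ∈ U(J)(F)`. [cite: PlatonovRapinchuk1994, §2.3] -/
theorem conj_mem_rational_iff {a : E} (ha : a ≠ 0) {J J' : Matrix (Fin N) (Fin N) E}
    (h : formCongr (c : E →+* E) B (a • J) = J') (γ : GL (Fin N) E) :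
    γ ∈ rational F E c N J' ↔ B * γ * B⁻¹ ∈ rational F E c N J := by
  rw [← rational_smul F E c N ha J]
  change _ ↔ _ ∈ unitaryGroupOfForm _ (a • J)
  rw [conj_mem_unitaryGroupOfForm_iff, h]
  rfl

/-- **`U(J')(𝔸_{F,f}) ≃ₜ* U(J)(𝔸_{F,f})`, `g ↦ B_f g B_f⁻¹`**, for a rational similitude `ᵗ(cB) · (a • J) · B = J'`
(an isomorphism of topological groups). [cite: PlatonovRapinchuk1994, §2.3] -/
def finAdelicCongr {a : E} (ha : a ≠ 0) {J J' : Matrix (Fin N) (Fin N) E}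
    (h : formCongr (c : E →+* E) B (a • J) = J') : finAdelic F E c N J' ≃ₜ* finAdelic F E c N J :=
  ContinuousMulEquiv.restrictSubgroup (GLn.conjEquiv (toFinAdeleGL E N B)) _ _
    (conj_mem_finAdelic_iff F E c B ha h)

omit [NumberField F] in
/-- `finAdelicCongr` on underlying elements: `B_f g B_f⁻¹`. [cite: PlatonovRapinchuk1994, §2.3] -/
@[simp] theorem coe_finAdelicCongr_apply {a : E} (ha : a ≠ 0) {J J' : Matrix (Fin N) (Fin N) E}
    (h : formCongr (c : E →+* E) B (a • J) = J') (g : finAdelic F E c N J') :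
    ((finAdelicCongr F E c B ha h g : finAdelic F E c N J) : GL (Fin N) (FiniteAdeleRing (𝓞 E) E)) =
      toFinAdeleGL E N B * g * (toFinAdeleGL E N B)⁻¹ := rfl

omit [NumberField F] in
/-- `finAdelicCongr.symm` on underlying elements: `B_f⁻¹ g B_f`. [cite: PlatonovRapinchuk1994, §2.3] -/
@[simp] theorem coe_finAdelicCongr_symm_apply {a : E} (ha : a ≠ 0) {J J' : Matrix (Fin N) (Fin N) E}
    (h : formCongr (c : E →+* E) B (a • J) = J') (g : finAdelic F E c N J) :
    (((finAdelicCongr F E c B ha h).symm g : finAdelic F E c N J') : GL (Fin N) (FiniteAdeleRing (𝓞 E) E)) =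
      (toFinAdeleGL E N B)⁻¹ * g * toFinAdeleGL E N B := rfl

omit [NumberField F] in
/-- **The diagonal intertwines the two conjugations**: `(B γ B⁻¹)_f = B_f γ_f B_f⁻¹` inside `U(J)(𝔸_{F,f})`, i.e.
`finAdelicCongr (γ_f) = (B γ B⁻¹)_f` for `γ ∈ U(J')(F)` (the diagonal embedding is a homomorphism of `GL_N`).
[cite: PlatonovRapinchuk1994, §5.1] -/
theorem finAdelicCongr_rationalToFinAdelic {a : E} (ha : a ≠ 0) {J J' : Matrix (Fin N) (Fin N) E}
    (h : formCongr (c : E →+* E) B (a • J) = J') (γ : rational F E c N J') :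
    finAdelicCongr F E c B ha h (rationalToFinAdelic F E c N J' γ) =
      rationalToFinAdelic F E c N J ⟨B * γ * B⁻¹, (conj_mem_rational_iff F E c B ha h γ).1 γ.2⟩ := by
  apply Subtype.ext
  rw [coe_finAdelicCongr_apply, coe_rationalToFinAdelic, coe_rationalToFinAdelic]
  simp only [map_mul, map_inv]

/-! ## 3. Arithmetic levels -/

omit [NumberField F] in
/-- **Arithmetic levels are transported by conjugation**: for `K ≤ U(J)(𝔸_{F,f})` and the transported level
`K' = finAdelicCongr⁻¹(K) ≤ U(J')(𝔸_{F,f})`, `γ ∈ Γ(K') ↔ B γ B⁻¹ ∈ Γ(K)`. [cite: PlatonovRapinchuk1994, §4.1] -/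
theorem mem_arithmeticLevel_transport_iff {a : E} (ha : a ≠ 0) {J J' : Matrix (Fin N) (Fin N) E}
    (h : formCongr (c : E →+* E) B (a • J) = J') (K : Subgroup (finAdelic F E c N J)) (γ : GL (Fin N) E) :
    γ ∈ arithmeticLevel F E c N J' (K.comap (finAdelicCongr F E c B ha h).toMonoidHom) ↔
      B * γ * B⁻¹ ∈ arithmeticLevel F E c N J K := by
  simp only [mem_arithmeticLevel_iff, Subgroup.mem_comap]
  constructor
  · rintro ⟨hγ, hK⟩
    refine ⟨(conj_mem_rational_iff F E c B ha h γ).1 hγ, ?_⟩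
    have hK' : finAdelicCongr F E c B ha h (rationalToFinAdelic F E c N J' ⟨γ, hγ⟩) ∈ K := hK
    rwa [finAdelicCongr_rationalToFinAdelic] at hK'
  · rintro ⟨hγ', hK⟩
    refine ⟨(conj_mem_rational_iff F E c B ha h γ).2 hγ', ?_⟩
    show finAdelicCongr F E c B ha h (rationalToFinAdelic F E c N J' ⟨γ, _⟩) ∈ K
    rw [finAdelicCongr_rationalToFinAdelic]
    exact hK

omit [NumberField F] in
/-- **`Γ(K') = B⁻¹ Γ(K) B`** as subgroups of `GL_N(E)` (`K' = finAdelicCongr⁻¹(K)`): the pull-back of `Γ(K)` under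
conjugation by `B`. [cite: PlatonovRapinchuk1994, §4.1] -/
theorem arithmeticLevel_transport {a : E} (ha : a ≠ 0) {J J' : Matrix (Fin N) (Fin N) E}
    (h : formCongr (c : E →+* E) B (a • J) = J') (K : Subgroup (finAdelic F E c N J)) :
    arithmeticLevel F E c N J' (K.comap (finAdelicCongr F E c B ha h).toMonoidHom) =
      (arithmeticLevel F E c N J K).comap (MulAut.conj B).toMonoidHom :=
  Subgroup.ext fun γ => by
    rw [mem_arithmeticLevel_transport_iff, Subgroup.mem_comap, MulEquiv.coe_toMonoidHom, MulAut.conj_apply]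

omit [NumberField F] in
/-- The transported level `K' = finAdelicCongr⁻¹(K)` is open when `K` is. [cite: PlatonovRapinchuk1994, §4.1] -/
theorem isOpen_comap_finAdelicCongr {a : E} (ha : a ≠ 0) {J J' : Matrix (Fin N) (Fin N) E}
    (h : formCongr (c : E →+* E) B (a • J) = J') 
    {K : Subgroup (finAdelic F E c N J)} (hK : IsOpen (K : Set (finAdelic F E c N J))) :
    IsOpen ((K.comap (finAdelicCongr F E c B ha h).toMonoidHom : Subgroup (finAdelic F E c N J')) :
      Set (finAdelic F E c N J')) :=
  hK.preimage (finAdelicCongr F E c B ha h).continuous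

omit [NumberField F] in
/-- The transported level `K' = finAdelicCongr⁻¹(K)` is compact when `K` is (preimage under a homeomorphism).
[cite: PlatonovRapinchuk1994, §4.1] -/
theorem isCompact_comap_finAdelicCongr {a : E} (ha : a ≠ 0) {J J' : Matrix (Fin N) (Fin N) E}
    (h : formCongr (c : E →+* E) B (a • J) = J') {K : Subgroup (finAdelic F E c N J)}
    (hK : IsCompact (K : Set (finAdelic F E c N J))) :
    IsCompact ((K.comap (finAdelicCongr F E c B ha h).toMonoidHom : Subgroup (finAdelic F E c N J')) :
      Set (finAdelic F E c N J')) :=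
  ((finAdelicCongr F E c B ha h).toHomeomorph.isCompact_preimage).2 hK

omit [NumberField F] in
/-- **Every element of `Γ(K)` comes from `Γ(K')`**: if `δ ∈ Γ(K)` then `B⁻¹ δ B ∈ Γ(K')`. [cite: PlatonovRapinchuk1994, §4.1] -/
theorem conj_inv_mem_arithmeticLevel_transport {a : E} (ha : a ≠ 0) {J J' : Matrix (Fin N) (Fin N) E}
    (h : formCongr (c : E →+* E) B (a • J) = J') 
    {K : Subgroup (finAdelic F E c N J)} {δ : GL (Fin N) E}
    (hδ : δ ∈ arithmeticLevel F E c N J K) :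
    B⁻¹ * δ * B ∈ arithmeticLevel F E c N J' (K.comap (finAdelicCongr F E c B ha h).toMonoidHom) := by
  have hB : B * (B⁻¹ * δ * B) * B⁻¹ = δ := by group
  rw [mem_arithmeticLevel_transport_iff, hB]
  exact hδ

end UnitaryGroup

end Literature.NumberTheory.Automorphic

end
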